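import Mathlib
import HarnessLib

/-!
# Simplicity of the top level from a thermal-trace bound
(stub `stub_simple_of_trace_lt` of line `twisted_trace_transfer` for crux
`QuarksAsStableAction.StableActionBridge`, item stmt-QuantumFields-9737, `--supports`; abstract lemma of step E3)

In step E3 of the line the `λᵢ ≥ 0` are the eigenvalues of the positive transfer operator of lattice QCD and
`Θ = Σᵢ λᵢ ^ t` is its thermal trace; the pressure clause bounds `Θ ≤ (1 + ε) λ_{i₀} ^ t` with `ε < 1`
eventually.  This file proves the abstract real-analysis lemma extracting SIMPLICITY of the top level (used by the
vacuum-parity clause): if `0 ≤ λᵢ` for all `i`, `HasSum (fun i => λᵢ ^ t) Θ` and `Θ < 2 λ_{i₀} ^ t`, then every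
index `i` with `λᵢ = λ_{i₀}` equals `i₀`.

Proof.  By contradiction: if `i ≠ i₀` had `λᵢ = λ_{i₀}`, the partial sum of the non-negative family
`j ↦ λⱼ ^ t` over the two-element `Finset` `{i, i₀}` equals `λᵢ ^ t + λ_{i₀} ^ t = 2 λ_{i₀} ^ t`
(`Finset.sum_pair`) and is at most the total `Θ` (`sum_le_hasSum` with non-negativity `pow_nonneg`),
contradicting `Θ < 2 λ_{i₀} ^ t` (`linarith`).  Pure theorem file (Mathlib only, no definitions).
-/

namespace Summit.QuantumFields.QCD.Cruxes.StableActionBridge.TwistedTraceTransfer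

/-- **Stub `stub_simple_of_trace_lt` of line `twisted_trace_transfer` (abstract lemma of E3): a thermal-trace
bound below twice the top term forces simplicity of the top level.**  If `0 ≤ lam i` for all `i`, the family
`i ↦ lam i ^ t` has sum `Θ`, and `Θ < 2 * lam i₀ ^ t`, then `lam i = lam i₀` implies `i = i₀`.
Proof: otherwise the partial sum over `{i, i₀}` is `2 * lam i₀ ^ t ≤ Θ` (`sum_le_hasSum`, `Finset.sum_pair`),
a contradiction. -/
theorem stub_simple_of_trace_lt : ∀ (ι : Type) (lam : ι → ℝ) (i₀ : ι) (t : ℕ) (Θ : ℝ),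
    (∀ i, 0 ≤ lam i) → HasSum (fun i => lam i ^ t) Θ → Θ < 2 * lam i₀ ^ t → ∀ i, lam i = lam i₀ → i = i₀ := by
  intro ι lam i₀ t Θ hnn hsum hlt i hi
  by_contra hne
  classical
  have h2 : ∑ j ∈ ({i, i₀} : Finset ι), lam j ^ t ≤ Θ :=
    sum_le_hasSum _ (fun j _ => pow_nonneg (hnn j) t) hsum
  rw [Finset.sum_pair hne, hi] at h2
  linarith

end Summit.QuantumFields.QCD.Cruxes.StableActionBridge.TwistedTraceTransfer
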